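import Literature.IUT.HodgeArakelov.MonoThetaSymmetries
import HarnessLib

/-!
# [IUTchII] Rmk 1.1.1 (iv): the `𝔽_l^{⋊±}`-symmetry record `FlSymmetry` — inhabitation CHARACTERISED
# (NV-L6 wave): it is inhabited iff the three printed structural clauses hold

S. Mochizuki, *Inter-universal Teichmüller theory II*, §1, Remark 1.1.1 (iv) (kurims pp. 23–24: "the natural
conjugation action of `Π_Y(M)` on `Π_M|_{(l·Δ_Θ)(M)}` factors through `Π_Y(M) ↠ G(M)` … the abelian profinite
group `Π_μ(M) ⋊ (l·Δ_Θ)(M)` … this commutator map is equivariant … the various subgroups … are stabilized …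
by the natural action by `(Π_C(M) ⊇) Δ_C(M) ↠ Δ_C(M)/Δ_X(M) ≅ 𝔽_l^{⋊±}`")
[cite: Mochizuki2012, Rmk 1.1.1 (iv) pp.23-24] [claim: Mochizuki2012, status: disputed].

PROOF-ONLY non-vacuity file (abc-iut cell, wave-5 prover abc-iut-w5-d219 gen 2, L6-lead §F v1.18p row call
«NV-L6 WAVE»; interface of `MonoThetaSymmetries.lean`). No `def`/`instance`/`structure` is declared; the
witnesses are built inside the theorem terms.

KERNEL-HONEST CONTENT. Over a Def. 1.1 (i) output `R`, theta-quotient data `T`, a core tower `W` and the two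
sections `Sec : TwoSections T W`, the typed record `FlSymmetry Sec` consists of
(a) ACTION DATA — `Π_C(M)`-actions on `Π_M|_{(l·Δ_Θ)}`, on `Δ_X/Δ_Y` and on `Δ^ell_Y` — with equivariance /
stability / factorisation clauses, and (b) three STRUCTURAL clauses that do not mention the actions:
`Π_M|_{(l·Δ_Θ)(M)}` is abelian, `Δ_X(M)` is normal in `Δ_C(M)`, and `Δ_C(M)/Δ_X(M) ≅ 𝔽_l^{⋊±}`.
The clauses (a) are satisfied by the TRIVIAL actions (DEGENERATE action data — said openly: the typed
Rmk 1.1.1 (iv) record does not pin the actions to conjugation), so: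

* `FlSymmetry.nonempty_of` — (b) ⇒ `Nonempty (FlSymmetry Sec)` (witness with degenerate = trivial actions);
* `FlSymmetry.abelian_of` / `deltaX_normal_of` / `quot_iso_Fl_of` — each clause of (b) is NECESSARY;
* `FlSymmetry.nonempty_iff` — inhabitation is EQUIVALENT to (b).

Consequently the ABSOLUTE inhabitation of `FlSymmetry` reduces to that of its parameter records
(`ThetaQuotientData`, `CoreTower`, `TwoSections` — separate NV-L6 rows) at a model where the three printed
structural clauses (b) hold; and `Rmk111_structures R C` reduces accordingly (`rmk111_structures_iff`).
INFO for the node registry: the action/equivariance fields of the typed Rmk 1.1.1 (iv) record are idle for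
inhabitation purposes (a faithful strengthening would tie `act` to the model embedding
`Π_M ↪ Π_μ(M) ⋊ Π_C(M)` of `Rmk111_iv_modelEmbedding`).

Nothing here takes a side on [IUTchIII] Cor. 3.12; a non-vacuity witness asserts only that the interface is
consistent; «not yet witnessed» ≠ «vacuous»; typed ≠ proved.
-/

namespace Literature.IUT.HodgeArakelov

universe u

variable {S : ThetaSetting.{u}} {M : MonoThetaEnv S} {R : Reconstruction M} {T : ThetaQuotientData R}
  {W : CoreTower R}

/-- **`FlSymmetry` from the three printed structural clauses** (DEGENERATE action data: the trivial
`Π_C(M)`-actions, which satisfy every factorisation / equivariance / stability field of the typed record).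
If `Π_M|_{(l·Δ_Θ)(M)}` is abelian, `Δ_X(M) ⊴ Δ_C(M)`, and `Δ_C(M)/Δ_X(M) ≅ 𝔽_l^{⋊±}`, then `FlSymmetry Sec` is
inhabited for every two-sections datum `Sec`. [cite: Mochizuki2012, Rmk 1.1.1 (iv) pp.23-24] -/
theorem FlSymmetry.nonempty_of (Sec : TwoSections T W)
    (hab : ∀ x y : T.envAtTheta.carrier, x * y = y * x)
    (hN : (W.DeltaXplain.subgroupOf W.DeltaC).Normal)
    (hq : Nonempty (W.DeltaC ⧸ W.DeltaXplain.subgroupOf W.DeltaC ≃*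
      Literature.IUT.HodgeTheaters.FlPM S.l)) :
    Nonempty (FlSymmetry Sec) :=
  ⟨{ act := 1
     act_factors := by rw [MonoidHom.ker_one]; exact le_top
     abelian := hab
     actlZ := 1
     actEll := 1
     commutator_equivariant := fun c a y => by
       simp only [MonoidHom.one_apply, MulAut.one_apply]
     sTheta_stable := fun c => by
       ext x
       simp only [MonoidHom.one_apply, Subgroup.mem_map, MulEquiv.coe_toMonoidHom, MulAut.one_apply,
         exists_eq_right]
     sAlg_stable := fun c => by
       ext x
       simp only [MonoidHom.one_apply, Subgroup.mem_map, MulEquiv.coe_toMonoidHom, MulAut.one_apply,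
         exists_eq_right]
     deltaX_normal := hN
     quot_iso_Fl := hq }⟩

/-- The abelian clause is NECESSARY: any `FlSymmetry Sec` records that `Π_M|_{(l·Δ_Θ)(M)}` is commutative.
[cite: Mochizuki2012, Rmk 1.1.1 (iv) p.23] -/
theorem FlSymmetry.abelian_of {Sec : TwoSections T W} (F : FlSymmetry Sec) (x y : T.envAtTheta.carrier) :
    x * y = y * x :=
  F.abelian x y

/-- The normality clause is NECESSARY: any `FlSymmetry Sec` records `Δ_X(M) ⊴ Δ_C(M)`.
[cite: Mochizuki2012, Rmk 1.1.1 (iv) p.24] -/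
theorem FlSymmetry.deltaX_normal_of {Sec : TwoSections T W} (F : FlSymmetry Sec) :
    (W.DeltaXplain.subgroupOf W.DeltaC).Normal :=
  F.deltaX_normal

/-- The normality and quotient clauses are NECESSARY: any `FlSymmetry Sec` records `Δ_X(M) ⊴ Δ_C(M)` with
`Δ_C(M)/Δ_X(M) ≅ 𝔽_l^{⋊±}` (the quotient group taken for that normal structure).
[cite: Mochizuki2012, Rmk 1.1.1 (iv) p.24] -/
theorem FlSymmetry.quot_iso_Fl_of {Sec : TwoSections T W} (F : FlSymmetry Sec) :
    ∃ _ : (W.DeltaXplain.subgroupOf W.DeltaC).Normal,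
      Nonempty (W.DeltaC ⧸ W.DeltaXplain.subgroupOf W.DeltaC ≃* Literature.IUT.HodgeTheaters.FlPM S.l) :=
  ⟨F.deltaX_normal, F.quot_iso_Fl⟩

/-- **Inhabitation of `FlSymmetry` CHARACTERISED**: for every two-sections datum `Sec` over `(R, T, W)`,
`FlSymmetry Sec` is inhabited iff `Π_M|_{(l·Δ_Θ)(M)}` is abelian, `Δ_X(M)` is normal in `Δ_C(M)`, and
`Δ_C(M)/Δ_X(M) ≅ 𝔽_l^{⋊±}` — the three printed structural clauses of Rmk 1.1.1 (iv); the action data of the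
typed record impose nothing further (trivial actions are admitted).
[cite: Mochizuki2012, Rmk 1.1.1 (iv) pp.23-24] -/
theorem FlSymmetry.nonempty_iff (Sec : TwoSections T W) :
    Nonempty (FlSymmetry Sec) ↔
      (∀ x y : T.envAtTheta.carrier, x * y = y * x) ∧
        ∃ _ : (W.DeltaXplain.subgroupOf W.DeltaC).Normal,
          Nonempty (W.DeltaC ⧸ W.DeltaXplain.subgroupOf W.DeltaC ≃*
            Literature.IUT.HodgeTheaters.FlPM S.l) := by
  constructor
  · rintro ⟨F⟩
    exact ⟨F.abelian_of, F.quot_iso_Fl_of⟩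
  · rintro ⟨hab, hN, hq⟩
    exact FlSymmetry.nonempty_of Sec hab hN hq

/-- **Rmk 1.1.1 existence predicate, reduced.** `Rmk111_structures R C` holds iff there are theta-quotient
data `T`, a core tower `W` and two sections `Sec` with the Def. 1.1 (ii) isomorphism their difference, such
that the three structural clauses of (iv) hold at `(T, W)` — the `FlSymmetry` conjunct contributes exactly
those clauses. [cite: Mochizuki2012, Rmk 1.1.1 pp.21-24] -/
theorem rmk111_structures_iff (R : Reconstruction M) (C : CyclotomicRigidity R) :
    Rmk111_structures R C ↔
      ∃ (T : ThetaQuotientData R) (W : CoreTower R) (Sec : TwoSections T W),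
        rigidity_is_difference Sec C ∧
          (∀ x y : T.envAtTheta.carrier, x * y = y * x) ∧
            ∃ _ : (W.DeltaXplain.subgroupOf W.DeltaC).Normal,
              Nonempty (W.DeltaC ⧸ W.DeltaXplain.subgroupOf W.DeltaC ≃*
                Literature.IUT.HodgeTheaters.FlPM S.l) := by
  constructor
  · rintro ⟨T, W, Sec, hdiff, hF⟩
    exact ⟨T, W, Sec, hdiff, (FlSymmetry.nonempty_iff Sec).mp hF⟩
  · rintro ⟨T, W, Sec, hdiff, h⟩
    exact ⟨T, W, Sec, hdiff, (FlSymmetry.nonempty_iff Sec).mpr h⟩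

end Literature.IUT.HodgeArakelov
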